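import Literature.AnabelianGeometry.EtaleTheta.KummerContainerZHatTwist
import HarnessLib

/-!
# Naturality of the Kummer map under automorphisms of a ROOT-CLOSED sub-pseudo-monoid (proof-only)

Sources.  LANA Project interim report [LANA2026Report], §6.1 "Generalities on Kummer maps", pp. 31–32 (the
Kummer map `κ : M → lim_{→ H} H¹(H, Λ(M))` and its functoriality square); S. Mochizuki, *Inter-universal
Teichmüller theory I*, kurims manuscript (May 2020), §0 p. 33 [Mochizuki2012] — a pseudo-monoid `P ⊆ M` is
*divisible* when "an element `a ∈ M` lies in `ι(P)` if and only if `aⁿ` lies in `ι(P)`" (the root- AND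
power-closure used below), *cyclotomic* when the torsion of `M` lies in `P` — and Example 5.1 (v) p. 127:
an isomorphism of pairs "consisting of a pseudo-monoid equipped with a continuous action" [a `Γ`-equivariant
bijection of the SUBSET respecting the partially defined products; abc-iut-L5-t1's `CoricPair.Iso`].
Classical: `Aut(Λ(R^×)) = Ẑ^×` [RibesZalesskii2010, Thm 2.7.1] (tree: `cyclotome.exists_zhatTwist_eq`).

**What was in the tree.**  `CoMorphism.kummerMap_equivariant_eq_twist` (abc-iut-w4-d056,
`KummerContainerZHatTwist.lean`): for a `G`-equivariant endomorphism `e` of the WHOLE module `A` acting on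
`Λ(A)` as the twist by `u ∈ Ẑ^×`, `κ(e a) = u · κ(a)`; the `Ẑ^×`-module structure `H1ColimTwist` /
`zhatMulAction` of the container `lim_{→} H¹(S i, Λ A)`.

**What this file proves** (PROOF-ONLY: no definition, no `Prop` fact).  Let `M ⊆ A` be `G`-stable with
`1 ∈ M` and `a ∈ M ⇔ aⁿ ∈ M` (`n ≥ 1`), and let `e` be a map `A → A` that is, ON `M`, valued in `M`,
multiplicative on products staying in `M`, and `G`-equivariant (only the values of `e` on `M` matter):
* `mem_of_pow_eq_one_of_closed`, `RootSystem.root_mem_of_closed` — the torsion of `A` and all roots of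
  elements of `M` lie in `M`; `apply_pow_of_partialMul` — `e (aⁿ) = (e a)ⁿ` on `M`;
* `RootSystem.exists_map_of_partialMul` — `e` transports compatible root systems of `a ∈ M` to root systems of
  `e a`; `cyclotome.exists_mulEquiv_of_partialMul` — given a partial inverse `e'`, `e` induces an
  AUTOMORPHISM `W` of the cyclotome `Λ(A)`, `(W ζ)_n = e(ζ_n)`;
* `RootSystem.kummerCocycle_apply_of_partialMul` — THE COCYCLE IDENTITY: the Kummer cocycle of `e a`
  (transported roots) is `e ∘` (Kummer cocycle of `a`) componentwise [`h · xₙ = c · xₙ` with `c` torsion,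
  hence in `M`, so `e(h · xₙ) = e(c) · e(xₙ)`];
* `kummerClass_eq_H1Twist_of_partialMul`, `kummerMap_eq_H1ColimTwist_of_partialMul` — if `e` acts on torsion
  as the twist by `u ∈ Ẑ^×`, then `κ(e a) = u · κ(a)` for all `a ∈ M`, at every level and in the container;
* `exists_zhatTwist_kummerMap_of_partialMul` — for `A = R^×`, `R` a domain with a primitive `n`-th root of
  unity for every `n` (e.g. `K̄`), and `e` with a partial inverse: **there is `u ∈ Ẑ^× = Aut(Ẑ)`, unique
  (`existsUnique_zhatTwist_of_partialMul`), with `e|_{μ_∞} = χ(u)` and `κ(e a) = u • κ(a)` for all `a ∈ M`.**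

Consumer: law (a) `hnat` of [IUTchI] Ex. 5.1 (v) (`CoricPair.kummerRigid_of_divisors`, GAP-LEDGER G-w4d056-2)
AT THE PAIR `π₁^rat ↷ 𝕄^⊛_∞κ` — whose pseudo-monoid is root-closed by Rmk 3.1.7 (ii) — in the companion
`Literature/IUT/HodgeTheaters/GlobalFrobenioidsCoricKummerNaturality.lean`.  HONEST FRAMING: classical Kummer
theory over Mathlib's group cohomology; OUR kernel check; nothing here bears on [IUTchIII] Cor. 3.12; no
statement of the disputed series is asserted.  Groups and modules live in `Type` (Mathlib's `groupCohomology`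
is single-universe), as in the landed Kummer files.
-/

namespace Literature.AnabelianGeometry.EtaleTheta

open groupCohomology ProfiniteGrp ProfiniteGrp.ProfiniteCompletion

/-! ## Closure bookkeeping for a root- and power-closed subset `M ⊆ A` -/

section Closure

variable {A : Type*} [CommGroup A] {M : Set A}

/-- If `1 ∈ M` and `a ∈ M ⇔ aⁿ ∈ M` for all `n ≥ 1`, then `M` contains every torsion element of `A`
(the pseudo-monoid is then *cyclotomic* as soon as it is *divisible*, IUTchI §0 p. 33).
[cite: Mochizuki2012, §0 p.33] -/
theorem mem_of_pow_eq_one_of_closed (h1 : (1 : A) ∈ M)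
    (hpow : ∀ (a : A) (n : ℕ), 0 < n → (a ∈ M ↔ a ^ n ∈ M)) {ζ : A} {n : ℕ} (hn : 0 < n)
    (hζ : ζ ^ n = 1) : ζ ∈ M :=
  (hpow ζ n hn).mpr (hζ ▸ h1)

/-- Powers of elements of `M` stay in `M` (including `a⁰ = 1`). [cite: Mochizuki2012, §0 p.33] -/
theorem pow_mem_of_closed (h1 : (1 : A) ∈ M) (hpow : ∀ (a : A) (n : ℕ), 0 < n → (a ∈ M ↔ a ^ n ∈ M))
    {a : A} (ha : a ∈ M) (n : ℕ) : a ^ n ∈ M := by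
  rcases Nat.eq_zero_or_pos n with rfl | hn
  · rwa [pow_zero]
  · exact (hpow a n hn).mp ha

/-- Every member of a compatible system of roots of `a ∈ M` lies in `M` (root-closure).
[cite: Mochizuki2012, §0 p.33] -/
theorem RootSystem.root_mem_of_closed (hpow : ∀ (a : A) (n : ℕ), 0 < n → (a ∈ M ↔ a ^ n ∈ M)) {a : A}
    (ha : a ∈ M) (x : RootSystem a) (n : ℕ+) : x.root n ∈ M :=
  (hpow (x.root n) n n.pos).mpr (by rw [x.pow_self]; exact ha)

variable {e : A → A}

/-- A map multiplicative on `M`-products sends `1 ∈ M` to `1`. [cite: Mochizuki2012, §0 p.33] -/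
theorem apply_one_of_partialMul (h1 : (1 : A) ∈ M)
    (hmul : ∀ a ∈ M, ∀ b ∈ M, a * b ∈ M → e (a * b) = e a * e b) : e 1 = 1 := by
  have h := hmul 1 h1 1 h1 (by rwa [mul_one])
  rw [mul_one] at h
  exact left_eq_mul.mp h

/-- A map multiplicative on `M`-products commutes with powers on `M` (all intermediate powers lie in `M`).
[cite: Mochizuki2012, §0 p.33] -/
theorem apply_pow_of_partialMul (h1 : (1 : A) ∈ M) (hpow : ∀ (a : A) (n : ℕ), 0 < n → (a ∈ M ↔ a ^ n ∈ M))
    (hmul : ∀ a ∈ M, ∀ b ∈ M, a * b ∈ M → e (a * b) = e a * e b) {a : A} (ha : a ∈ M) (n : ℕ) :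
    e (a ^ n) = e a ^ n := by
  induction n with
  | zero => rw [pow_zero, pow_zero, apply_one_of_partialMul h1 hmul]
  | succ n ih =>
    rw [pow_succ, pow_succ, hmul _ (pow_mem_of_closed h1 hpow ha n) a ha
      (by rw [← pow_succ]; exact pow_mem_of_closed h1 hpow ha _), ih]

/-- **`e` transports root systems**: for `a ∈ M` and a compatible system of roots `x` of `a` (all in `M`),
`n ↦ e(xₙ)` is a compatible system of roots of `e a`. [cite: LANA2026Report, §6.1 p.31] -/
theorem RootSystem.exists_map_of_partialMul (h1 : (1 : A) ∈ M)
    (hpow : ∀ (a : A) (n : ℕ), 0 < n → (a ∈ M ↔ a ^ n ∈ M))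
    (hmul : ∀ a ∈ M, ∀ b ∈ M, a * b ∈ M → e (a * b) = e a * e b) {a : A} (ha : a ∈ M) (x : RootSystem a) :
    ∃ y : RootSystem (e a), ∀ n : ℕ+, y.root n = e (x.root n) :=
  ⟨⟨fun n => e (x.root n), by rw [x.root_one], fun n m => by
      rw [← apply_pow_of_partialMul h1 hpow hmul (x.root_mem_of_closed hpow ha (n * m)), x.root_mul_pow]⟩,
    fun _ => rfl⟩

/-- **`e` induces an automorphism of the cyclotome.**  If `e` has a partial inverse `e'` on `M` with the same
properties, then `ζ ↦ (e(ζ_n))_n` is a group AUTOMORPHISM `W` of `Λ(A) = lim_n A[n]` (torsion lies in `M`, on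
which `e` is multiplicative and bijective).  Stated existentially (proof-only file).
[cite: LANA2026Report, §6.1 p.31] -/
theorem cyclotome.exists_mulEquiv_of_partialMul {e' : A → A} (h1 : (1 : A) ∈ M)
    (hpow : ∀ (a : A) (n : ℕ), 0 < n → (a ∈ M ↔ a ^ n ∈ M))
    (hmul : ∀ a ∈ M, ∀ b ∈ M, a * b ∈ M → e (a * b) = e a * e b)
    (hmul' : ∀ a ∈ M, ∀ b ∈ M, a * b ∈ M → e' (a * b) = e' a * e' b)
    (he'e : ∀ a ∈ M, e' (e a) = a) (hee' : ∀ a ∈ M, e (e' a) = a) :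
    ∃ W : cyclotome A ≃* cyclotome A, ∀ (ζ : cyclotome A) (n : ℕ+),
      ((W ζ : cyclotome A) : ℕ+ → A) n = e ((ζ : ℕ+ → A) n) := by
  -- components of elements of the cyclotome are torsion, hence lie in `M`
  have hmem : ∀ (ζ : cyclotome A) (n : ℕ+), (ζ : ℕ+ → A) n ∈ M := fun ζ n =>
    mem_of_pow_eq_one_of_closed h1 hpow n.pos (cyclotome.pow_eq_one ζ n)
  have hmulmem : ∀ (ζ ξ : cyclotome A) (n : ℕ+), (ζ : ℕ+ → A) n * (ξ : ℕ+ → A) n ∈ M := fun ζ ξ n =>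
    hmem (ζ * ξ) n
  -- the forward and backward maps on compatible systems
  have hfwd : ∀ {f : A → A}, (∀ a ∈ M, ∀ b ∈ M, a * b ∈ M → f (a * b) = f a * f b) →
      ∀ ζ : cyclotome A, (fun n => f ((ζ : ℕ+ → A) n)) ∈ cyclotome A := by
    intro f hf ζ
    refine ⟨fun n => ?_, fun n m => ?_⟩
    · rw [← apply_pow_of_partialMul h1 hpow hf (hmem ζ n), cyclotome.pow_eq_one,
        apply_one_of_partialMul h1 hf]
    · rw [← apply_pow_of_partialMul h1 hpow hf (hmem ζ (n * m)), cyclotome.pow_apply_mul]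
  refine ⟨{ toFun := fun ζ => ⟨fun n => e ((ζ : ℕ+ → A) n), hfwd hmul ζ⟩
            invFun := fun ζ => ⟨fun n => e' ((ζ : ℕ+ → A) n), hfwd hmul' ζ⟩
            left_inv := fun ζ => Subtype.ext (funext fun n => he'e _ (hmem ζ n))
            right_inv := fun ζ => Subtype.ext (funext fun n => hee' _ (hmem ζ n))
            map_mul' := fun ζ ξ => Subtype.ext (funext fun n =>
              hmul _ (hmem ζ n) _ (hmem ξ n) (hmulmem ζ ξ n)) }, fun ζ n => rfl⟩

end Closure

/-! ## The cocycle identity and the level-`H` class identity -/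

section Level

variable {G : Type*} [Group G] {A : Type*} [CommGroup A] [MulDistribMulAction G A] {M : Set A} {e : A → A}

/-- **THE COCYCLE IDENTITY.**  Let `M ⊆ A` be `G`-stable, `1 ∈ M`, `a ∈ M ⇔ aⁿ ∈ M`; `e` multiplicative on
`M`-products and `G`-equivariant on `M`; `a ∈ M` fixed by `H`, `x` a compatible system of roots of `a` and `y`
the transported system of roots of `e a`.  Then the Kummer cocycle of `e a` is `e ∘` (the Kummer cocycle of
`a`) componentwise: `(h · yₙ)/yₙ = e((h · xₙ)/xₙ)` — since `h · xₙ = c · xₙ` with `c` torsion, so `c ∈ M` and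
`e(h · xₙ) = e(c) · e(xₙ)`. [cite: LANA2026Report, §6.1 p.31] -/
theorem RootSystem.kummerCocycle_apply_of_partialMul (hsmul : ∀ (g : G) (a : A), a ∈ M → g • a ∈ M)
    (h1 : (1 : A) ∈ M) (hpow : ∀ (a : A) (n : ℕ), 0 < n → (a ∈ M ↔ a ^ n ∈ M))
    (hmul : ∀ a ∈ M, ∀ b ∈ M, a * b ∈ M → e (a * b) = e a * e b)
    (hesmul : ∀ (g : G), ∀ a ∈ M, e (g • a) = g • e a) {H : Subgroup G} {a : A} (ha : a ∈ M)
    (haH : a ∈ MulAction.fixedPoints H A) (heH : e a ∈ MulAction.fixedPoints H A) (x : RootSystem a)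
    (y : RootSystem (e a)) (hy : ∀ n : ℕ+, y.root n = e (x.root n)) (h : H) (n : ℕ+) :
    ((y.kummerCocycle heH h : cyclotome A) : ℕ+ → A) n =
      e (((x.kummerCocycle haH h : cyclotome A) : ℕ+ → A) n) := by
  rw [RootSystem.kummerCocycle_apply, RootSystem.kummerCocycle_apply, hy n]
  have hxn : x.root n ∈ M := x.root_mem_of_closed hpow ha n
  -- `c := (h · xₙ)/xₙ` is `n`-torsion, hence in `M`
  have hc : (h • x.root n) / x.root n ∈ M := by
    refine mem_of_pow_eq_one_of_closed h1 hpow n.pos ?_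
    rw [div_pow, ← smul_pow', x.pow_self, show h • a = a from haH h, div_self']
  have hprod : (h • x.root n) / x.root n * x.root n ∈ M := by
    rw [div_mul_cancel]; exact hsmul _ _ hxn
  have key : e (h • x.root n) = e ((h • x.root n) / x.root n) * e (x.root n) := by
    rw [← hmul _ hc _ hxn hprod, div_mul_cancel]
  rw [show (h • e (x.root n) : A) = (h : G) • e (x.root n) from rfl, ← hesmul _ _ hxn,
    show ((h : G) • x.root n : A) = h • x.root n from rfl, key, mul_div_cancel_right]

end Level

section Class

variable {G : Type} [Group G] {A : Type} [CommGroup A] [MulDistribMulAction G A] {M : Set A} {e : A → A}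
  [RootableBy A ℕ]

/-- **Level-`H` class identity**: if moreover `e` acts on torsion as the twist by `u ∈ Ẑ^× = Aut(Ẑ)`
[`e(ζ_n) = ζ_n ^ χ_n(u)`], then `κ_H(e a) = u · κ_H(a)` in `H¹(H, Λ(A))` for every `a ∈ M` fixed by `H`
(`H1Twist`, abc-iut-w4-d056's `KummerContainerZHatTwist.lean`).  Proof: compute both classes with the root
systems `x` / `e ∘ x`; the cocycles differ by the coefficient map `u · (−)` (`H1π_comp_map`).
[cite: LANA2026Report, §6.1 p.31] -/
theorem kummerClass_eq_H1Twist_of_partialMul (hsmul : ∀ (g : G) (a : A), a ∈ M → g • a ∈ M)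
    (h1 : (1 : A) ∈ M) (hpow : ∀ (a : A) (n : ℕ), 0 < n → (a ∈ M ↔ a ^ n ∈ M))
    (hmul : ∀ a ∈ M, ∀ b ∈ M, a * b ∈ M → e (a * b) = e a * e b)
    (hesmul : ∀ (g : G), ∀ a ∈ M, e (g • a) = g • e a)
    (u : MulAut (completion (GrpCat.of (Multiplicative ℤ))))
    (hΛ : ∀ (ζ : cyclotome A) (n : ℕ+),
      e ((ζ : ℕ+ → A) n) = ((cyclotome.zhatTwist A u ζ : cyclotome A) : ℕ+ → A) n)
    (H : Subgroup G) {a : A} (ha : a ∈ M) (haH : a ∈ invariants (A := A) H)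
    (heH : e a ∈ invariants (A := A) H) :
    kummerClass H ⟨e a, heH⟩ = H1Twist (A := A) H u (kummerClass H ⟨a, haH⟩) := by
  obtain ⟨y, hy⟩ := RootSystem.exists_map_of_partialMul h1 hpow hmul ha (RootSystem.ofRootableBy a)
  rw [kummerClass_eq_of_rootSystem H ⟨e a, heH⟩ y]
  change kummerClassOfRootSystem H y heH =
    H1Twist (A := A) H u (kummerClassOfRootSystem H (RootSystem.ofRootableBy a) haH)
  rw [kummerClassOfRootSystem, kummerClassOfRootSystem, H1Twist, H1π_comp_map_apply]
  congr 1
  refine cocycles₁_ext fun γ => ?_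
  rw [coe_mapCocycles₁]
  change Additive.ofMul (y.kummerCocycle heH γ) =
    (cyclotomeRepTwist (A := A) H u).hom (kummerCocycles₁ H (RootSystem.ofRootableBy a) haH γ)
  rw [kummerCocycles₁_apply, cyclotomeRepTwist_hom_apply, toMul_ofMul]
  congr 1
  exact Subtype.ext (funext fun n =>
    (RootSystem.kummerCocycle_apply_of_partialMul hsmul h1 hpow hmul hesmul ha haH heH
      (RootSystem.ofRootableBy a) y hy γ n).trans (hΛ _ n))

variable {ι : Type} [Preorder ι] [DecidableEq ι] [IsDirectedOrder ι] (S : ι → Subgroup G)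
  (hS : ∀ ⦃i j : ι⦄, i ≤ j → S j ≤ S i)

/-- **`κ(e a) = u · κ(a)` IN THE KUMMER CONTAINER** `lim_{→ i} H¹(S i, Λ A)` for every `a ∈ M`, under the
same hypotheses (`H1ColimTwist`, abc-iut-w4-d056's `KummerContainerZHatTwist.lean`): both sides are computed
at a level fixing `a` — which also fixes `e a`, by equivariance. [cite: LANA2026Report, §6.1 p.31] -/
theorem kummerMap_eq_H1ColimTwist_of_partialMul (hc : IsExhausted A S)
    (hsmul : ∀ (g : G) (a : A), a ∈ M → g • a ∈ M) (h1 : (1 : A) ∈ M)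
    (hpow : ∀ (a : A) (n : ℕ), 0 < n → (a ∈ M ↔ a ^ n ∈ M))
    (hmul : ∀ a ∈ M, ∀ b ∈ M, a * b ∈ M → e (a * b) = e a * e b)
    (hesmul : ∀ (g : G), ∀ a ∈ M, e (g • a) = g • e a)
    (u : MulAut (completion (GrpCat.of (Multiplicative ℤ))))
    (hΛ : ∀ (ζ : cyclotome A) (n : ℕ+),
      e ((ζ : ℕ+ → A) n) = ((cyclotome.zhatTwist A u ζ : cyclotome A) : ℕ+ → A) n)
    {a : A} (ha : a ∈ M) :
    kummerMap hS hc (e a) = H1ColimTwist S hS u (kummerMap hS hc a) := by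
  obtain ⟨i, hi⟩ := hc a
  have hei : e a ∈ invariants (A := A) (S i) := fun γ => by
    change (γ : G) • e a = e a
    rw [← hesmul _ _ ha, show ((γ : G) • a : A) = γ • a from rfl, show γ • a = a from hi γ]
  rw [kummerMap_eq_of hS hc (e a) i hei, kummerMap_eq_of hS hc a i hi, H1ColimTwist_toColimit,
    kummerClass_eq_H1Twist_of_partialMul hsmul h1 hpow hmul hesmul u hΛ (S i) ha hi hei]

/-- The same in the `MulAction` notation of `zhatMulAction`: `κ(e a) = u • κ(a)` for `a ∈ M`.
[cite: LANA2026Report, §6.1 p.31] -/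
theorem kummerMap_eq_smul_of_partialMul [Nonempty ι] (hc : IsExhausted A S)
    (hsmul : ∀ (g : G) (a : A), a ∈ M → g • a ∈ M) (h1 : (1 : A) ∈ M)
    (hpow : ∀ (a : A) (n : ℕ), 0 < n → (a ∈ M ↔ a ^ n ∈ M))
    (hmul : ∀ a ∈ M, ∀ b ∈ M, a * b ∈ M → e (a * b) = e a * e b)
    (hesmul : ∀ (g : G), ∀ a ∈ M, e (g • a) = g • e a)
    (u : MulAut (completion (GrpCat.of (Multiplicative ℤ))))
    (hΛ : ∀ (ζ : cyclotome A) (n : ℕ+),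
      e ((ζ : ℕ+ → A) n) = ((cyclotome.zhatTwist A u ζ : cyclotome A) : ℕ+ → A) n)
    {a : A} (ha : a ∈ M) :
    kummerMap hS hc (e a) = (letI := zhatMulAction (A := A) S hS; u • kummerMap hS hc a) :=
  kummerMap_eq_H1ColimTwist_of_partialMul S hS hc hsmul h1 hpow hmul hesmul u hΛ ha

end Class

/-! ## `A = R^×`: the twisting element exists (and is unique) for every partial automorphism -/

section Units

variable {G : Type} [Group G] {R : Type} [CommRing R] [IsDomain R] [MulDistribMulAction G Rˣ]
  [RootableBy Rˣ ℕ] {ι : Type} [Preorder ι] [DecidableEq ι] [IsDirectedOrder ι]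
  (S : ι → Subgroup G) (hS : ∀ ⦃i j : ι⦄, i ≤ j → S j ≤ S i) {M : Set Rˣ} {e e' : Rˣ → Rˣ}

/-- **NATURALITY OF THE KUMMER MAP UNDER AUTOMORPHISMS OF A ROOT-CLOSED SUB-PSEUDO-MONOID** ([IUTchI]
Ex. 5.1 (v) law (a) AT THE PAIR; GAP-LEDGER G-w4d056-2): let `R` be a domain with a primitive `n`-th root of
unity for every `n ≥ 1` (e.g. `K̄`), `M ⊆ R^×` `G`-stable with `1 ∈ M` and `a ∈ M ⇔ aⁿ ∈ M`, and `e`, `e'`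
mutually inverse on `M`, multiplicative on `M`-products, `e` `G`-equivariant on `M` [an automorphism of the
pair `G ↷ M`].  THEN there is `u ∈ Ẑ^× = Aut(Ẑ)` — the cyclotomic character of `e|_{μ_∞}`
(`cyclotome.exists_zhatTwist_eq`) — with `e(ζ_n) = ζ_n ^ χ_n(u)` on torsion and **`κ(e a) = u · κ(a)` for every
`a ∈ M`**. [cite: LANA2026Report, §6.1 p.32] -/
theorem exists_zhatTwist_kummerMap_of_partialMul (hprim : ∀ n : ℕ, 0 < n → ∃ ζ : R, IsPrimitiveRoot ζ n)
    (hc : IsExhausted Rˣ S) (hsmul : ∀ (g : G) (a : Rˣ), a ∈ M → g • a ∈ M) (h1 : (1 : Rˣ) ∈ M)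
    (hpow : ∀ (a : Rˣ) (n : ℕ), 0 < n → (a ∈ M ↔ a ^ n ∈ M))
    (hmul : ∀ a ∈ M, ∀ b ∈ M, a * b ∈ M → e (a * b) = e a * e b)
    (hmul' : ∀ a ∈ M, ∀ b ∈ M, a * b ∈ M → e' (a * b) = e' a * e' b)
    (he'e : ∀ a ∈ M, e' (e a) = a) (hee' : ∀ a ∈ M, e (e' a) = a)
    (hesmul : ∀ (g : G), ∀ a ∈ M, e (g • a) = g • e a) :
    ∃ u : MulAut (completion (GrpCat.of (Multiplicative ℤ))),
      (∀ (ζ : cyclotome Rˣ) (n : ℕ+),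
        e ((ζ : ℕ+ → Rˣ) n) = ((cyclotome.zhatTwist Rˣ u ζ : cyclotome Rˣ) : ℕ+ → Rˣ) n) ∧
      ∀ a ∈ M, kummerMap hS hc (e a) = H1ColimTwist S hS u (kummerMap hS hc a) := by
  obtain ⟨W, hW⟩ := cyclotome.exists_mulEquiv_of_partialMul h1 hpow hmul hmul' he'e hee'
  obtain ⟨u, hu⟩ := cyclotome.exists_zhatTwist_eq hprim W
  have hΛ : ∀ (ζ : cyclotome Rˣ) (n : ℕ+),
      e ((ζ : ℕ+ → Rˣ) n) = ((cyclotome.zhatTwist Rˣ u ζ : cyclotome Rˣ) : ℕ+ → Rˣ) n := fun ζ n => by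
    rw [← hW ζ n, hu ζ]
  exact ⟨u, hΛ, fun a ha => kummerMap_eq_H1ColimTwist_of_partialMul S hS hc hsmul h1 hpow hmul hesmul u hΛ ha⟩

omit [MulDistribMulAction G Rˣ] [RootableBy Rˣ ℕ] in
/-- The twisting element is UNIQUE: `u ∈ Ẑ^×` is determined by the action of `e` on torsion (faithfulness of
`Ẑ^× ↷ Λ(R^×)`, `cyclotome.eq_of_zhatTwist_eq`). [cite: LANA2026Report, §6.1 p.32] -/
theorem zhatTwist_unique_of_partialMul (hprim : ∀ n : ℕ, 0 < n → ∃ ζ : R, IsPrimitiveRoot ζ n)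
    {u v : MulAut (completion (GrpCat.of (Multiplicative ℤ)))}
    (hu : ∀ (ζ : cyclotome Rˣ) (n : ℕ+),
      e ((ζ : ℕ+ → Rˣ) n) = ((cyclotome.zhatTwist Rˣ u ζ : cyclotome Rˣ) : ℕ+ → Rˣ) n)
    (hv : ∀ (ζ : cyclotome Rˣ) (n : ℕ+),
      e ((ζ : ℕ+ → Rˣ) n) = ((cyclotome.zhatTwist Rˣ v ζ : cyclotome Rˣ) : ℕ+ → Rˣ) n) : u = v :=
  cyclotome.eq_of_zhatTwist_eq hprim fun ζ => Subtype.ext (funext fun n => (hu ζ n).symm.trans (hv ζ n))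

/-- **`∃! u`**: the element of `Ẑ^×` through which an automorphism of the pair `G ↷ M` acts on Kummer classes
exists and is unique. [cite: LANA2026Report, §6.1 p.32] -/
theorem existsUnique_zhatTwist_of_partialMul (hprim : ∀ n : ℕ, 0 < n → ∃ ζ : R, IsPrimitiveRoot ζ n)
    (hc : IsExhausted Rˣ S) (hsmul : ∀ (g : G) (a : Rˣ), a ∈ M → g • a ∈ M) (h1 : (1 : Rˣ) ∈ M)
    (hpow : ∀ (a : Rˣ) (n : ℕ), 0 < n → (a ∈ M ↔ a ^ n ∈ M))
    (hmul : ∀ a ∈ M, ∀ b ∈ M, a * b ∈ M → e (a * b) = e a * e b)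
    (hmul' : ∀ a ∈ M, ∀ b ∈ M, a * b ∈ M → e' (a * b) = e' a * e' b)
    (he'e : ∀ a ∈ M, e' (e a) = a) (hee' : ∀ a ∈ M, e (e' a) = a)
    (hesmul : ∀ (g : G), ∀ a ∈ M, e (g • a) = g • e a) :
    ∃! u : MulAut (completion (GrpCat.of (Multiplicative ℤ))),
      (∀ (ζ : cyclotome Rˣ) (n : ℕ+),
        e ((ζ : ℕ+ → Rˣ) n) = ((cyclotome.zhatTwist Rˣ u ζ : cyclotome Rˣ) : ℕ+ → Rˣ) n) ∧
      ∀ a ∈ M, kummerMap hS hc (e a) = H1ColimTwist S hS u (kummerMap hS hc a) := by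
  obtain ⟨u, hu, hκ⟩ :=
    exists_zhatTwist_kummerMap_of_partialMul S hS hprim hc hsmul h1 hpow hmul hmul' he'e hee' hesmul
  exact ⟨u, ⟨hu, hκ⟩, fun v hv => zhatTwist_unique_of_partialMul hprim hv.1 hu⟩

end Units

end Literature.AnabelianGeometry.EtaleTheta
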